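import Literature.Analysis.FunctionSpaces.PolchinskiRegularity
import Literature.Analysis.FunctionSpaces.PolchinskiFamilyDerivative
import Literature.Analysis.FunctionSpaces.PolchinskiSmoothing
import Literature.Analysis.FunctionSpaces.PolchinskiUniformSlope
import HarnessLib

/-!
# Smoothed jets for the Polchinski semigroup: the Gaussian averages of `e^{−V₀}`, `e^{−V₀}F` and their
# derivatives up to order three, as `C_b²` functions of space and uniformly differentiable families in time
# (spatial/temporal regularity of `P_{0,t}F = W_t/Z_t` for Bauerschmidt–Bodineau–Dagallier, Theorem 3)

Topic `Literature/Analysis/FunctionSpaces`; "proof architecture" file behind the named fact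
`Polchinski.BauerschmidtBodineau_multiscaleBakryEmery` ([BBD] Theorem 3, `MultiscaleBakryEmery.lean`).
[BBD]'s proof writes `P_{0,t}F = W_t/Z_t` with `W_t(y) = E_{C_t}[e^{−V₀}F(y+ζ)]`, `Z_t(y) = E_{C_t}[e^{−V₀}(y+ζ)]`
(proof of Prop 8, p0015 L9–12) and differentiates: twice in space for the generator `L_t` (Prop 8),
three times in space and once in time for Lemma 1 (the Bochner formula for `(∇√P_{0,t}F)²_{Ċ_t}`,
p0016–p0017).  In the tree's degenerate-covariance rendering all these derivatives are Gaussian averages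
of the corresponding derivatives of the integrands ("jets").  For `Ψ ∈ C⁴` with bounded derivatives
(`PolchinskiRegularity.lean`) and any probability measure `P` this file provides, for the ATOMS
`y ↦ E_P[Ψ(y+ζ)]` and `y ↦ E_P[∂_kΨ(y+ζ)]`:
the `HasFDerivAt` chains to second order with explicit jet derivatives, the evaluation of the
operator-valued averages on basis vectors, the sup bounds, uniform continuity in `y`, the symmetry of
the second jets, positivity lower bounds for `Z_t` and `W_t`, and — for `P = P_{C_s}` along the
decomposition — the time derivative / uniform slope at `s = t` ([BBD] Prop 5); the closure rules for
quotients such as `W_t/Z_t` are in `PolchinskiCb2Calculus.lean`.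

## Main results (sorry-free; no new definitions, no new named facts)

* `sm_hasFDerivAt`, `sm_hasFDerivAt_fderiv`, `sm_partial_hasFDerivAt`, `sm_partial_hasFDerivAt_fderiv` —
  derivatives of the smoothed atoms; `sm_fderiv_apply`, … — basis evaluations; bounds; uniform continuity;
* `sm_scalar₂`, `sm_scalar₃` — scalar second/third jets; `sm_pack`, `sm_partial_pack` — the `C_b²` 6-tuples;
* `sm_uniformSlope`, `sm_partial_uniformSlope` — uniform-in-space time slopes along `C_s` ([BBD] Prop 5);
* `exp_neg_le_integral_exp_neg`, `integral_exp_neg_mul_mem` — `Z ≥ e^{−B_V}`, `aZ ≤ W ≤ bZ`.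

Nothing here concerns Yang–Mills.

## References

* [BauerschmidtBodineauDagallier2023] R. Bauerschmidt, T. Bodineau, B. Dagallier, Probab. Surveys 21
  (2024) 200–290, arXiv:2307.07619 — Prop 5 p0012, Prop 8 proof p0015 L9–32, Thm 3 proof and Lemma 1
  p0016–p0017. READ (held text `paper:arxiv-2307.07619`).
-/

noncomputable section

-- nested operator-norm instances `E →L[ℝ] E →L[ℝ] E →L[ℝ] ℝ`
set_option maxSynthPendingDepth 4

open MeasureTheory ProbabilityTheory Filter Topology Set
open scoped RealInnerProductSpace Matrix MatrixOrder

namespace Literature.Analysis.FunctionSpaces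

namespace Polchinski

variable {N : ℕ}

/-! ### Helpers -/

section Helpers

/-- Uniform continuity from a bounded Fréchet derivative. [folklore] -/
private theorem uc_of_fderiv_bound {Y : Type*} [NormedAddCommGroup Y] [NormedSpace ℝ Y]
    {H : EuclideanSpace ℝ (Fin N) → Y} {DH : EuclideanSpace ℝ (Fin N) → EuclideanSpace ℝ (Fin N) →L[ℝ] Y}
    (h1 : ∀ x, HasFDerivAt H (DH x) x) {K : ℝ} (hK : ∀ x, ‖DH x‖ ≤ K) : UniformContinuous H := by
  have hK0 : 0 ≤ K := le_trans (norm_nonneg _) (hK 0)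
  have hlip : ∀ a b : EuclideanSpace ℝ (Fin N), ‖H a - H b‖ ≤ K * ‖a - b‖ := fun a b =>
    Convex.norm_image_sub_le_of_norm_hasFDerivWithin_le (𝕜 := ℝ) (s := univ)
      (fun x _ => (h1 x).hasFDerivWithinAt) (fun x _ => hK x) convex_univ (mem_univ b) (mem_univ a)
  rw [Metric.uniformContinuous_iff]
  intro ε hε
  refine ⟨ε / (K + 1), by positivity, fun {a b} hab => ?_⟩
  rw [dist_eq_norm] at hab ⊢
  calc ‖H a - H b‖ ≤ K * ‖a - b‖ := hlip a b
    _ ≤ K * (ε / (K + 1)) := mul_le_mul_of_nonneg_left hab.le hK0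
    _ < ε := by
      rw [mul_div_assoc', div_lt_iff₀ (by positivity)]
      nlinarith

/-- A bounded continuous shifted integrand is integrable on a finite measure. [folklore] -/
private theorem integrable_shift {Y : Type*} [NormedAddCommGroup Y] [NormedSpace ℝ Y]
    {H : EuclideanSpace ℝ (Fin N) → Y} (hHc : Continuous H)
    {MH : ℝ} (hH : ∀ x, ‖H x‖ ≤ MH) (P : Measure (EuclideanSpace ℝ (Fin N))) [IsFiniteMeasure P]
    (y : EuclideanSpace ℝ (Fin N)) : Integrable (fun ζ => H (y + ζ)) P :=
  Integrable.of_bound (hHc.comp (continuous_const.add continuous_id)).aestronglyMeasurable MH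
    (Eventually.of_forall fun ζ => hH (y + ζ))

/-- `|∫ f| ≤ C` on a probability space when `|f| ≤ C`. [folklore] -/
private theorem abs_integral_le_of_abs_le {f : EuclideanSpace ℝ (Fin N) → ℝ} {C : ℝ}
    (P : Measure (EuclideanSpace ℝ (Fin N))) [IsProbabilityMeasure P] (hf : ∀ x, |f x| ≤ C) :
    |∫ x, f x ∂P| ≤ C := by
  have h := norm_integral_le_of_norm_le_const (μ := P) (f := f) (C := C)
    (Eventually.of_forall fun x => by rw [Real.norm_eq_abs]; exact hf x)
  rwa [Real.norm_eq_abs, probReal_univ, mul_one] at h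

end Helpers

/-! ### The smoothed atoms `y ↦ E_P[Ψ(y+ζ)]`, `y ↦ E_P[∂_kΨ(y+ζ)]` for `Ψ ∈ C_b⁴` -/

section Atoms

variable {Ψ : EuclideanSpace ℝ (Fin N) → ℝ} {B : ℝ}

/-- Continuity facts for `Ψ`, `∇Ψ`, `D²Ψ`, `D³Ψ`. [cite: BauerschmidtBodineauDagallier2023, Theorem 3 (proof)] -/
theorem atom_continuous (hΨ : ContDiff ℝ 4 Ψ) (hB : ∀ n ≤ 4, ∀ x, ‖iteratedFDeriv ℝ n Ψ x‖ ≤ B) :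
    Continuous Ψ ∧ Continuous (fderiv ℝ Ψ) ∧ Continuous (fderiv ℝ (fderiv ℝ Ψ)) ∧
      Continuous (fderiv ℝ (fderiv ℝ (fderiv ℝ Ψ))) :=
  ⟨hΨ.continuous,
   continuous_iff_continuousAt.2 fun x => (Cb4.hasFDerivAt_fderiv hΨ x).continuousAt,
   (Cb4.uniformContinuous_fderiv₂ hΨ hB).continuous,
   (Cb4.uniformContinuous_fderiv₃ hΨ hB).continuous⟩

/-- Uniform continuity of `Ψ` and `∇Ψ` (bounded derivatives). [cite: BauerschmidtBodineauDagallier2023, Theorem 3 (proof)] -/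
theorem atom_uniformContinuous (hΨ : ContDiff ℝ 4 Ψ) (hB : ∀ n ≤ 4, ∀ x, ‖iteratedFDeriv ℝ n Ψ x‖ ≤ B) : UniformContinuous Ψ ∧ UniformContinuous (fderiv ℝ Ψ) :=
  ⟨uc_of_fderiv_bound (Cb4.hasFDerivAt hΨ) (Cb4.norm_fderiv_le hB),
   uc_of_fderiv_bound (Cb4.hasFDerivAt_fderiv hΨ) (Cb4.norm_fderiv₂_le hB)⟩

/-- **Spatial gradient of the smoothed atom**: `∇_y E_P[Ψ(y+ζ)] = E_P[∇Ψ(y+ζ)]`.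
[cite: BauerschmidtBodineauDagallier2023, Proposition 8 (proof)] -/
theorem sm_hasFDerivAt (hΨ : ContDiff ℝ 4 Ψ) (hB : ∀ n ≤ 4, ∀ x, ‖iteratedFDeriv ℝ n Ψ x‖ ≤ B)
    (P : Measure (EuclideanSpace ℝ (Fin N))) [IsProbabilityMeasure P] (y : EuclideanSpace ℝ (Fin N)) :
    HasFDerivAt (fun y => ∫ ζ, Ψ (y + ζ) ∂P) (∫ ζ, fderiv ℝ Ψ (y + ζ) ∂P) y :=
  hasFDerivAt_integral_shift (Cb4.hasFDerivAt hΨ) (atom_continuous hΨ hB).2.1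
    (fun x => by rw [Real.norm_eq_abs]; exact Cb4.abs_le hB x) (Cb4.norm_fderiv_le hB) P y

/-- **Spatial Hessian of the smoothed atom**: `∇_y E_P[∇Ψ(y+ζ)] = E_P[D²Ψ(y+ζ)]`.
[cite: BauerschmidtBodineauDagallier2023, Proposition 8 (proof)] -/
theorem sm_hasFDerivAt_fderiv (hΨ : ContDiff ℝ 4 Ψ) (hB : ∀ n ≤ 4, ∀ x, ‖iteratedFDeriv ℝ n Ψ x‖ ≤ B)
    (P : Measure (EuclideanSpace ℝ (Fin N))) [IsProbabilityMeasure P] (y : EuclideanSpace ℝ (Fin N)) :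
    HasFDerivAt (fun y => ∫ ζ, fderiv ℝ Ψ (y + ζ) ∂P) (∫ ζ, fderiv ℝ (fderiv ℝ Ψ) (y + ζ) ∂P) y :=
  hasFDerivAt_integral_shift (Cb4.hasFDerivAt_fderiv hΨ) (atom_continuous hΨ hB).2.2.1
    (Cb4.norm_fderiv_le hB) (Cb4.norm_fderiv₂_le hB) P y

/-- Gradient of the smoothed partial `y ↦ E_P[∂_vΨ(y+ζ)]`: `E_P[D²Ψ(y+ζ)v]`.
[cite: BauerschmidtBodineauDagallier2023, Theorem 3 (proof)] -/
theorem sm_partial_hasFDerivAt (hΨ : ContDiff ℝ 4 Ψ) (hB : ∀ n ≤ 4, ∀ x, ‖iteratedFDeriv ℝ n Ψ x‖ ≤ B)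
    (P : Measure (EuclideanSpace ℝ (Fin N))) [IsProbabilityMeasure P] (v y : EuclideanSpace ℝ (Fin N)) :
    HasFDerivAt (fun y => ∫ ζ, fderiv ℝ Ψ (y + ζ) v ∂P)
      (∫ ζ, fderiv ℝ (fderiv ℝ Ψ) (y + ζ) v ∂P) y :=
  hasFDerivAt_integral_shift (G := fun x => fderiv ℝ Ψ x v) (Cb4.hasFDerivAt_partial hΨ v)
    ((ContinuousLinearMap.apply ℝ (EuclideanSpace ℝ (Fin N) →L[ℝ] ℝ) v).continuous.comp
      (atom_continuous hΨ hB).2.2.1)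
    (fun x => by rw [Real.norm_eq_abs]; exact Cb4.abs_partial_le hB v x)
    (Cb4.norm_fderiv₂_apply_le hB v) P y

/-- Hessian of the smoothed partial: `∇_y E_P[D²Ψ(y+ζ)v] = E_P[D³Ψ(y+ζ)v]`.
[cite: BauerschmidtBodineauDagallier2023, Theorem 3 (proof)] -/
theorem sm_partial_hasFDerivAt_fderiv (hΨ : ContDiff ℝ 4 Ψ) (hB : ∀ n ≤ 4, ∀ x, ‖iteratedFDeriv ℝ n Ψ x‖ ≤ B)
    (P : Measure (EuclideanSpace ℝ (Fin N))) [IsProbabilityMeasure P] (v y : EuclideanSpace ℝ (Fin N)) :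
    HasFDerivAt (fun y => ∫ ζ, fderiv ℝ (fderiv ℝ Ψ) (y + ζ) v ∂P)
      (∫ ζ, fderiv ℝ (fderiv ℝ (fderiv ℝ Ψ)) (y + ζ) v ∂P) y :=
  hasFDerivAt_integral_shift (G := fun x => fderiv ℝ (fderiv ℝ Ψ) x v)
    (Cb4.hasFDerivAt_fderiv_partial hΨ v)
    ((ContinuousLinearMap.apply ℝ (EuclideanSpace ℝ (Fin N) →L[ℝ] EuclideanSpace ℝ (Fin N) →L[ℝ] ℝ)
      v).continuous.comp (atom_continuous hΨ hB).2.2.2)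
    (Cb4.norm_fderiv₂_apply_le hB v) (Cb4.norm_fderiv₃_apply_le hB v) P y

/-! #### Basis evaluations of the operator-valued averages -/

/-- `(E_P[∇Ψ(y+ζ)]) v = E_P[∂_vΨ(y+ζ)]`. [cite: BauerschmidtBodineauDagallier2023, Theorem 3 (proof)] -/
theorem sm_fderiv_apply (hΨ : ContDiff ℝ 4 Ψ) (hB : ∀ n ≤ 4, ∀ x, ‖iteratedFDeriv ℝ n Ψ x‖ ≤ B)
    (P : Measure (EuclideanSpace ℝ (Fin N))) [IsProbabilityMeasure P] (y v : EuclideanSpace ℝ (Fin N)) :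
    (∫ ζ, fderiv ℝ Ψ (y + ζ) ∂P) v = ∫ ζ, fderiv ℝ Ψ (y + ζ) v ∂P := by
  rw [ContinuousLinearMap.integral_apply
    (integrable_shift (atom_continuous hΨ hB).2.1 (Cb4.norm_fderiv_le hB) P y) v]

/-- `(E_P[D²Ψ(y+ζ)]) v w = E_P[D²Ψ(y+ζ) v w]`. [cite: BauerschmidtBodineauDagallier2023, Theorem 3 (proof)] -/
theorem sm_fderiv₂_apply (hΨ : ContDiff ℝ 4 Ψ) (hB : ∀ n ≤ 4, ∀ x, ‖iteratedFDeriv ℝ n Ψ x‖ ≤ B)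
    (P : Measure (EuclideanSpace ℝ (Fin N))) [IsProbabilityMeasure P] (y v w : EuclideanSpace ℝ (Fin N)) :
    (∫ ζ, fderiv ℝ (fderiv ℝ Ψ) (y + ζ) ∂P) v w = ∫ ζ, fderiv ℝ (fderiv ℝ Ψ) (y + ζ) v w ∂P := by
  have hI := integrable_shift (atom_continuous hΨ hB).2.2.1 (Cb4.norm_fderiv₂_le hB) P y
  have hI1 : Integrable (fun ζ => fderiv ℝ (fderiv ℝ Ψ) (y + ζ) v) P :=
    (ContinuousLinearMap.apply ℝ (EuclideanSpace ℝ (Fin N) →L[ℝ] ℝ) v).integrable_comp hI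
  rw [ContinuousLinearMap.integral_apply hI v, ContinuousLinearMap.integral_apply hI1 w]

/-- `(E_P[D²Ψ(y+ζ)v]) w = E_P[D²Ψ(y+ζ) v w]`. [cite: BauerschmidtBodineauDagallier2023, Theorem 3 (proof)] -/
theorem sm_partial_fderiv_apply (hΨ : ContDiff ℝ 4 Ψ) (hB : ∀ n ≤ 4, ∀ x, ‖iteratedFDeriv ℝ n Ψ x‖ ≤ B)
    (P : Measure (EuclideanSpace ℝ (Fin N))) [IsProbabilityMeasure P] (y v w : EuclideanSpace ℝ (Fin N)) :
    (∫ ζ, fderiv ℝ (fderiv ℝ Ψ) (y + ζ) v ∂P) w = ∫ ζ, fderiv ℝ (fderiv ℝ Ψ) (y + ζ) v w ∂P := by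
  have hI : Integrable (fun ζ => fderiv ℝ (fderiv ℝ Ψ) (y + ζ) v) P :=
    integrable_shift (Y := EuclideanSpace ℝ (Fin N) →L[ℝ] ℝ) (H := fun x => fderiv ℝ (fderiv ℝ Ψ) x v)
      ((ContinuousLinearMap.apply ℝ (EuclideanSpace ℝ (Fin N) →L[ℝ] ℝ) v).continuous.comp
        (atom_continuous hΨ hB).2.2.1) (Cb4.norm_fderiv₂_apply_le hB v) P y
  rw [ContinuousLinearMap.integral_apply hI w]

/-- `(E_P[D³Ψ(y+ζ)v]) w u = E_P[D³Ψ(y+ζ) v w u]`. [cite: BauerschmidtBodineauDagallier2023, Theorem 3 (proof)] -/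
theorem sm_partial_fderiv₂_apply (hΨ : ContDiff ℝ 4 Ψ) (hB : ∀ n ≤ 4, ∀ x, ‖iteratedFDeriv ℝ n Ψ x‖ ≤ B)
    (P : Measure (EuclideanSpace ℝ (Fin N))) [IsProbabilityMeasure P] (y v w u : EuclideanSpace ℝ (Fin N)) :
    (∫ ζ, fderiv ℝ (fderiv ℝ (fderiv ℝ Ψ)) (y + ζ) v ∂P) w u =
      ∫ ζ, fderiv ℝ (fderiv ℝ (fderiv ℝ Ψ)) (y + ζ) v w u ∂P := by
  have hI : Integrable (fun ζ => fderiv ℝ (fderiv ℝ (fderiv ℝ Ψ)) (y + ζ) v) P :=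
    integrable_shift (Y := EuclideanSpace ℝ (Fin N) →L[ℝ] EuclideanSpace ℝ (Fin N) →L[ℝ] ℝ)
      (H := fun x => fderiv ℝ (fderiv ℝ (fderiv ℝ Ψ)) x v)
      ((ContinuousLinearMap.apply ℝ
        (EuclideanSpace ℝ (Fin N) →L[ℝ] EuclideanSpace ℝ (Fin N) →L[ℝ] ℝ) v).continuous.comp
        (atom_continuous hΨ hB).2.2.2) (Cb4.norm_fderiv₃_apply_le hB v) P y
  have hI1 : Integrable (fun ζ => fderiv ℝ (fderiv ℝ (fderiv ℝ Ψ)) (y + ζ) v w) P :=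
    (ContinuousLinearMap.apply ℝ (EuclideanSpace ℝ (Fin N) →L[ℝ] ℝ) w).integrable_comp hI
  rw [ContinuousLinearMap.integral_apply hI w, ContinuousLinearMap.integral_apply hI1 u]

/-! #### Bounds -/

/-- `|E_P[Ψ(y+ζ)]| ≤ B`. [cite: BauerschmidtBodineauDagallier2023, Theorem 3 (proof)] -/
theorem sm_abs_le (hB : ∀ n ≤ 4, ∀ x, ‖iteratedFDeriv ℝ n Ψ x‖ ≤ B)
    (P : Measure (EuclideanSpace ℝ (Fin N))) [IsProbabilityMeasure P] (y : EuclideanSpace ℝ (Fin N)) : |∫ ζ, Ψ (y + ζ) ∂P| ≤ B :=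
  abs_integral_le_of_abs_le P fun _ => Cb4.abs_le hB _

/-- `‖E_P[∇Ψ(y+ζ)]‖ ≤ B`. [cite: BauerschmidtBodineauDagallier2023, Theorem 3 (proof)] -/
theorem sm_norm_fderiv_le (hB : ∀ n ≤ 4, ∀ x, ‖iteratedFDeriv ℝ n Ψ x‖ ≤ B)
    (P : Measure (EuclideanSpace ℝ (Fin N))) [IsProbabilityMeasure P] (y : EuclideanSpace ℝ (Fin N)) : ‖∫ ζ, fderiv ℝ Ψ (y + ζ) ∂P‖ ≤ B :=
  norm_integral_shift_le (Cb4.norm_fderiv_le hB) P y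

/-- `‖E_P[D²Ψ(y+ζ)]‖ ≤ B`. [cite: BauerschmidtBodineauDagallier2023, Theorem 3 (proof)] -/
theorem sm_norm_fderiv₂_le (hB : ∀ n ≤ 4, ∀ x, ‖iteratedFDeriv ℝ n Ψ x‖ ≤ B)
    (P : Measure (EuclideanSpace ℝ (Fin N))) [IsProbabilityMeasure P] (y : EuclideanSpace ℝ (Fin N)) :
    ‖∫ ζ, fderiv ℝ (fderiv ℝ Ψ) (y + ζ) ∂P‖ ≤ B :=
  norm_integral_shift_le (Cb4.norm_fderiv₂_le hB) P y

/-- `|E_P[∂_vΨ(y+ζ)]| ≤ B‖v‖`. [cite: BauerschmidtBodineauDagallier2023, Theorem 3 (proof)] -/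
theorem sm_partial_abs_le (hB : ∀ n ≤ 4, ∀ x, ‖iteratedFDeriv ℝ n Ψ x‖ ≤ B)
    (P : Measure (EuclideanSpace ℝ (Fin N))) [IsProbabilityMeasure P] (v y : EuclideanSpace ℝ (Fin N)) :
    |∫ ζ, fderiv ℝ Ψ (y + ζ) v ∂P| ≤ B * ‖v‖ :=
  abs_integral_le_of_abs_le P fun _ => Cb4.abs_partial_le hB v _

/-- `‖E_P[D²Ψ(y+ζ)v]‖ ≤ B‖v‖`. [cite: BauerschmidtBodineauDagallier2023, Theorem 3 (proof)] -/
theorem sm_partial_norm_fderiv_le (hB : ∀ n ≤ 4, ∀ x, ‖iteratedFDeriv ℝ n Ψ x‖ ≤ B)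
    (P : Measure (EuclideanSpace ℝ (Fin N))) [IsProbabilityMeasure P] (v y : EuclideanSpace ℝ (Fin N)) :
    ‖∫ ζ, fderiv ℝ (fderiv ℝ Ψ) (y + ζ) v ∂P‖ ≤ B * ‖v‖ :=
  norm_integral_shift_le (H := fun x => fderiv ℝ (fderiv ℝ Ψ) x v) (Cb4.norm_fderiv₂_apply_le hB v) P y

/-- `‖E_P[D³Ψ(y+ζ)v]‖ ≤ B‖v‖`. [cite: BauerschmidtBodineauDagallier2023, Theorem 3 (proof)] -/
theorem sm_partial_norm_fderiv₂_le (hB : ∀ n ≤ 4, ∀ x, ‖iteratedFDeriv ℝ n Ψ x‖ ≤ B)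
    (P : Measure (EuclideanSpace ℝ (Fin N))) [IsProbabilityMeasure P] (v y : EuclideanSpace ℝ (Fin N)) :
    ‖∫ ζ, fderiv ℝ (fderiv ℝ (fderiv ℝ Ψ)) (y + ζ) v ∂P‖ ≤ B * ‖v‖ :=
  norm_integral_shift_le (H := fun x => fderiv ℝ (fderiv ℝ (fderiv ℝ Ψ)) x v)
    (Cb4.norm_fderiv₃_apply_le hB v) P y

/-! #### Uniform continuity in `y` -/

/-- The smoothed atom and its first two jets are uniformly continuous in `y`.
[cite: BauerschmidtBodineauDagallier2023, Theorem 3 (proof)] -/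
theorem sm_uniformContinuous (hΨ : ContDiff ℝ 4 Ψ) (hB : ∀ n ≤ 4, ∀ x, ‖iteratedFDeriv ℝ n Ψ x‖ ≤ B)
    (P : Measure (EuclideanSpace ℝ (Fin N))) [IsProbabilityMeasure P] :
    UniformContinuous (fun y => ∫ ζ, Ψ (y + ζ) ∂P) ∧
      UniformContinuous (fun y => ∫ ζ, fderiv ℝ Ψ (y + ζ) ∂P) ∧
      UniformContinuous (fun y => ∫ ζ, fderiv ℝ (fderiv ℝ Ψ) (y + ζ) ∂P) := by
  obtain ⟨hc0, hc1, hc2, -⟩ := atom_continuous hΨ hB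
  obtain ⟨hu0, hu1⟩ := atom_uniformContinuous hΨ hB
  exact ⟨uniformContinuous_integral_shift hc0 (fun x => by rw [Real.norm_eq_abs]; exact Cb4.abs_le hB x)
      hu0 P,
    uniformContinuous_integral_shift hc1 (Cb4.norm_fderiv_le hB) hu1 P,
    uniformContinuous_integral_shift hc2 (Cb4.norm_fderiv₂_le hB) (Cb4.uniformContinuous_fderiv₂ hΨ hB) P⟩

/-- The smoothed partial `E_P[∂_vΨ(y+ζ)]` and its two jets are uniformly continuous in `y`.
[cite: BauerschmidtBodineauDagallier2023, Theorem 3 (proof)] -/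
theorem sm_partial_uniformContinuous (hΨ : ContDiff ℝ 4 Ψ) (hB : ∀ n ≤ 4, ∀ x, ‖iteratedFDeriv ℝ n Ψ x‖ ≤ B)
    (P : Measure (EuclideanSpace ℝ (Fin N))) [IsProbabilityMeasure P] (v : EuclideanSpace ℝ (Fin N)) :
    UniformContinuous (fun y => ∫ ζ, fderiv ℝ Ψ (y + ζ) v ∂P) ∧
      UniformContinuous (fun y => ∫ ζ, fderiv ℝ (fderiv ℝ Ψ) (y + ζ) v ∂P) ∧
      UniformContinuous (fun y => ∫ ζ, fderiv ℝ (fderiv ℝ (fderiv ℝ Ψ)) (y + ζ) v ∂P) := by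
  obtain ⟨-, hc1, hc2, hc3⟩ := atom_continuous hΨ hB
  obtain ⟨-, hu1⟩ := atom_uniformContinuous hΨ hB
  have ev1 := (ContinuousLinearMap.apply ℝ ℝ v).uniformContinuous
  have ev2 := (ContinuousLinearMap.apply ℝ (EuclideanSpace ℝ (Fin N) →L[ℝ] ℝ) v).uniformContinuous
  refine ⟨?_, ?_, ?_⟩
  · exact uniformContinuous_integral_shift (H := fun x => fderiv ℝ Ψ x v)
      ((ContinuousLinearMap.apply ℝ ℝ v).continuous.comp hc1)
      (fun x => by rw [Real.norm_eq_abs]; exact Cb4.abs_partial_le hB v x) (ev1.comp hu1) P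
  · exact uniformContinuous_integral_shift (H := fun x => fderiv ℝ (fderiv ℝ Ψ) x v)
      ((ContinuousLinearMap.apply ℝ (EuclideanSpace ℝ (Fin N) →L[ℝ] ℝ) v).continuous.comp hc2)
      (Cb4.norm_fderiv₂_apply_le hB v) (ev2.comp (Cb4.uniformContinuous_fderiv₂ hΨ hB)) P
  · exact uniformContinuous_integral_shift (H := fun x => fderiv ℝ (fderiv ℝ (fderiv ℝ Ψ)) x v)
      ((ContinuousLinearMap.apply ℝ
        (EuclideanSpace ℝ (Fin N) →L[ℝ] EuclideanSpace ℝ (Fin N) →L[ℝ] ℝ) v).continuous.comp hc3)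
      (Cb4.norm_fderiv₃_apply_le hB v) (Cb4.uniformContinuous_fderiv₃_apply hΨ hB v) P

/-! #### Symmetry of the second and third jets -/

/-- `E_P[D²Ψ(y+ζ) v w] = E_P[D²Ψ(y+ζ) w v]`. [cite: BauerschmidtBodineauDagallier2023, Theorem 3 (proof)] -/
theorem sm_fderiv₂_symm (hΨ : ContDiff ℝ 4 Ψ) (P : Measure (EuclideanSpace ℝ (Fin N)))
    (y v w : EuclideanSpace ℝ (Fin N)) :
    ∫ ζ, fderiv ℝ (fderiv ℝ Ψ) (y + ζ) v w ∂P = ∫ ζ, fderiv ℝ (fderiv ℝ Ψ) (y + ζ) w v ∂P := by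
  refine integral_congr_ae (Eventually.of_forall fun ζ => ?_)
  exact Cb4.fderiv₂_symm hΨ _ v w

/-- `E_P[D³Ψ(y+ζ) v w u]` is symmetric in `(v, w)` and in `(w, u)`.
[cite: BauerschmidtBodineauDagallier2023, Theorem 3 (proof)] -/
theorem sm_fderiv₃_symm (hΨ : ContDiff ℝ 4 Ψ) (P : Measure (EuclideanSpace ℝ (Fin N)))
    (y v w u : EuclideanSpace ℝ (Fin N)) :
    (∫ ζ, fderiv ℝ (fderiv ℝ (fderiv ℝ Ψ)) (y + ζ) v w u ∂P =
      ∫ ζ, fderiv ℝ (fderiv ℝ (fderiv ℝ Ψ)) (y + ζ) w v u ∂P) ∧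
    (∫ ζ, fderiv ℝ (fderiv ℝ (fderiv ℝ Ψ)) (y + ζ) v w u ∂P =
      ∫ ζ, fderiv ℝ (fderiv ℝ (fderiv ℝ Ψ)) (y + ζ) v u w ∂P) := by
  refine ⟨integral_congr_ae (Eventually.of_forall fun ζ => ?_),
    integral_congr_ae (Eventually.of_forall fun ζ => ?_)⟩
  · simp only []
    rw [Cb4.fderiv₃_symm₁₂ hΨ _ v w]
  · simp only []
    exact Cb4.fderiv₃_symm₂₃ hΨ _ v w u


/-! #### Scalar second and third jets -/

/-- The scalar second jet `y ↦ E_P[D²Ψ(y+ζ) v w]`: continuous, bounded by `B‖v‖‖w‖`, uniformly continuous.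
[cite: BauerschmidtBodineauDagallier2023, Theorem 3 (proof)] -/
theorem sm_scalar₂ (hΨ : ContDiff ℝ 4 Ψ) (hB : ∀ n ≤ 4, ∀ x, ‖iteratedFDeriv ℝ n Ψ x‖ ≤ B)
    (P : Measure (EuclideanSpace ℝ (Fin N))) [IsProbabilityMeasure P] (v w : EuclideanSpace ℝ (Fin N)) :
    Continuous (fun y => ∫ ζ, fderiv ℝ (fderiv ℝ Ψ) (y + ζ) v w ∂P) ∧
    (∀ y, |∫ ζ, fderiv ℝ (fderiv ℝ Ψ) (y + ζ) v w ∂P| ≤ B * ‖v‖ * ‖w‖) ∧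
    UniformContinuous (fun y => ∫ ζ, fderiv ℝ (fderiv ℝ Ψ) (y + ζ) v w ∂P) := by
  have hfun : (fun y => ∫ ζ, fderiv ℝ (fderiv ℝ Ψ) (y + ζ) v w ∂P) =
      fun y => (∫ ζ, fderiv ℝ (fderiv ℝ Ψ) (y + ζ) v ∂P) w :=
    funext fun y => (sm_partial_fderiv_apply hΨ hB P y v w).symm
  have huc : UniformContinuous (fun y => ∫ ζ, fderiv ℝ (fderiv ℝ Ψ) (y + ζ) v w ∂P) := by
    rw [hfun]
    exact (ContinuousLinearMap.apply ℝ ℝ w).uniformContinuous.comp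
      (sm_partial_uniformContinuous hΨ hB P v).2.1
  refine ⟨huc.continuous, fun y => abs_integral_le_of_abs_le P fun x => ?_, huc⟩
  rw [← Real.norm_eq_abs]
  exact (ContinuousLinearMap.le_opNorm _ _).trans
    (mul_le_mul_of_nonneg_right (Cb4.norm_fderiv₂_apply_le hB v _) (norm_nonneg _))

/-- The scalar third jet `y ↦ E_P[D³Ψ(y+ζ) v w u]`: continuous, bounded by `B‖v‖‖w‖‖u‖`, uniformly
continuous. [cite: BauerschmidtBodineauDagallier2023, Theorem 3 (proof)] -/
theorem sm_scalar₃ (hΨ : ContDiff ℝ 4 Ψ) (hB : ∀ n ≤ 4, ∀ x, ‖iteratedFDeriv ℝ n Ψ x‖ ≤ B)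
    (P : Measure (EuclideanSpace ℝ (Fin N))) [IsProbabilityMeasure P]
    (v w u : EuclideanSpace ℝ (Fin N)) :
    Continuous (fun y => ∫ ζ, fderiv ℝ (fderiv ℝ (fderiv ℝ Ψ)) (y + ζ) v w u ∂P) ∧
    (∀ y, |∫ ζ, fderiv ℝ (fderiv ℝ (fderiv ℝ Ψ)) (y + ζ) v w u ∂P| ≤ B * ‖v‖ * ‖w‖ * ‖u‖) ∧
    UniformContinuous (fun y => ∫ ζ, fderiv ℝ (fderiv ℝ (fderiv ℝ Ψ)) (y + ζ) v w u ∂P) := by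
  have hfun : (fun y => ∫ ζ, fderiv ℝ (fderiv ℝ (fderiv ℝ Ψ)) (y + ζ) v w u ∂P) =
      fun y => (∫ ζ, fderiv ℝ (fderiv ℝ (fderiv ℝ Ψ)) (y + ζ) v ∂P) w u :=
    funext fun y => (sm_partial_fderiv₂_apply hΨ hB P y v w u).symm
  have huc : UniformContinuous (fun y => ∫ ζ, fderiv ℝ (fderiv ℝ (fderiv ℝ Ψ)) (y + ζ) v w u ∂P) := by
    rw [hfun]
    exact ((ContinuousLinearMap.apply ℝ ℝ u).comp
      (ContinuousLinearMap.apply ℝ (EuclideanSpace ℝ (Fin N) →L[ℝ] ℝ) w)).uniformContinuous.comp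
      (sm_partial_uniformContinuous hΨ hB P v).2.2
  refine ⟨huc.continuous, fun y => abs_integral_le_of_abs_le P fun x => ?_, huc⟩
  rw [← Real.norm_eq_abs]
  refine (ContinuousLinearMap.le_opNorm _ _).trans (mul_le_mul_of_nonneg_right ?_ (norm_nonneg _))
  exact (ContinuousLinearMap.le_opNorm _ _).trans
    (mul_le_mul_of_nonneg_right (Cb4.norm_fderiv₃_apply_le hB v _) (norm_nonneg _))

/-! #### `C_b²` packs of the atoms (the 6-tuples consumed by `PolchinskiCb2Calculus`) -/

/-- The `C_b²` pack of the smoothed atom `y ↦ E_P[Ψ(y+ζ)]`.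
[cite: BauerschmidtBodineauDagallier2023, Proposition 8 (proof)] -/
theorem sm_pack (hΨ : ContDiff ℝ 4 Ψ) (hB : ∀ n ≤ 4, ∀ x, ‖iteratedFDeriv ℝ n Ψ x‖ ≤ B)
    (P : Measure (EuclideanSpace ℝ (Fin N))) [IsProbabilityMeasure P] :
    (∀ y, HasFDerivAt (fun y => ∫ ζ, Ψ (y + ζ) ∂P) (∫ ζ, fderiv ℝ Ψ (y + ζ) ∂P) y) ∧
    (∀ y, HasFDerivAt (fun y => ∫ ζ, fderiv ℝ Ψ (y + ζ) ∂P)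
      (∫ ζ, fderiv ℝ (fderiv ℝ Ψ) (y + ζ) ∂P) y) ∧
    (∀ y, |∫ ζ, Ψ (y + ζ) ∂P| ≤ B) ∧ (∀ y, ‖∫ ζ, fderiv ℝ Ψ (y + ζ) ∂P‖ ≤ B) ∧
    (∀ y, ‖∫ ζ, fderiv ℝ (fderiv ℝ Ψ) (y + ζ) ∂P‖ ≤ B) ∧
    UniformContinuous (fun y => ∫ ζ, fderiv ℝ (fderiv ℝ Ψ) (y + ζ) ∂P) :=
  ⟨sm_hasFDerivAt hΨ hB P, sm_hasFDerivAt_fderiv hΨ hB P, sm_abs_le hB P, sm_norm_fderiv_le hB P,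
    sm_norm_fderiv₂_le hB P, (sm_uniformContinuous hΨ hB P).2.2⟩

/-- The `C_b²` pack of the smoothed partial `y ↦ E_P[∂_vΨ(y+ζ)]`.
[cite: BauerschmidtBodineauDagallier2023, Theorem 3 (proof)] -/
theorem sm_partial_pack (hΨ : ContDiff ℝ 4 Ψ) (hB : ∀ n ≤ 4, ∀ x, ‖iteratedFDeriv ℝ n Ψ x‖ ≤ B)
    (P : Measure (EuclideanSpace ℝ (Fin N))) [IsProbabilityMeasure P] (v : EuclideanSpace ℝ (Fin N)) :
    (∀ y, HasFDerivAt (fun y => ∫ ζ, fderiv ℝ Ψ (y + ζ) v ∂P)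
      (∫ ζ, fderiv ℝ (fderiv ℝ Ψ) (y + ζ) v ∂P) y) ∧
    (∀ y, HasFDerivAt (fun y => ∫ ζ, fderiv ℝ (fderiv ℝ Ψ) (y + ζ) v ∂P)
      (∫ ζ, fderiv ℝ (fderiv ℝ (fderiv ℝ Ψ)) (y + ζ) v ∂P) y) ∧
    (∀ y, |∫ ζ, fderiv ℝ Ψ (y + ζ) v ∂P| ≤ B * ‖v‖) ∧
    (∀ y, ‖∫ ζ, fderiv ℝ (fderiv ℝ Ψ) (y + ζ) v ∂P‖ ≤ B * ‖v‖) ∧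
    (∀ y, ‖∫ ζ, fderiv ℝ (fderiv ℝ (fderiv ℝ Ψ)) (y + ζ) v ∂P‖ ≤ B * ‖v‖) ∧
    UniformContinuous (fun y => ∫ ζ, fderiv ℝ (fderiv ℝ (fderiv ℝ Ψ)) (y + ζ) v ∂P) :=
  ⟨sm_partial_hasFDerivAt hΨ hB P v, sm_partial_hasFDerivAt_fderiv hΨ hB P v, sm_partial_abs_le hB P v,
    sm_partial_norm_fderiv_le hB P v, sm_partial_norm_fderiv₂_le hB P v,
    (sm_partial_uniformContinuous hΨ hB P v).2.2⟩

/-! #### Time slopes along the decomposition ([BBD] Prop 5) -/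

/-- **Uniform-in-space time slope of the smoothed atom** along `C_s` at `t > 0`:
`d/ds E_{C_s}[Ψ(y+·)]|_{s=t} = ½ Σ Ċ_t^{ij} E_{C_t}[∂_i∂_jΨ(y+·)]`, uniformly in `y`.
[cite: BauerschmidtBodineauDagallier2023, Proposition 5] -/
theorem sm_uniformSlope (D : CovDecomposition N) (hΨ : ContDiff ℝ 4 Ψ)
    (hB : ∀ n ≤ 4, ∀ x, ‖iteratedFDeriv ℝ n Ψ x‖ ≤ B) {t : ℝ} (ht : 0 < t) :
    ∀ ε : ℝ, 0 < ε → ∀ᶠ s in 𝓝 t, ∀ y : EuclideanSpace ℝ (Fin N),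
      |(∫ ζ, Ψ (y + ζ) ∂(multivariateGaussian 0 (D.C s))) -
          (∫ ζ, Ψ (y + ζ) ∂(multivariateGaussian 0 (D.C t))) -
          (s - t) * ((1 / 2) * ∑ i, ∑ j, D.Cdot t i j *
            ∫ w, fderiv ℝ (fderiv ℝ Ψ) (y + w) (EuclideanSpace.single i 1) (EuclideanSpace.single j 1)
              ∂(multivariateGaussian 0 (D.C t)))| ≤ ε * |s - t| :=
  fun _ hε => eventually_abs_integral_sub_sub_mul_le D (Cb4.hasFDerivAt hΨ) (Cb4.hasFDerivAt_fderiv hΨ)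
    (Cb4.abs_le hB) (Cb4.norm_fderiv₂_le hB) (Cb4.uniformContinuous_fderiv₂ hΨ hB) ht hε

/-- **Uniform-in-space time slope of the smoothed partial** `E_{C_s}[∂_vΨ(y+·)]` at `t > 0`:
`½ Σ Ċ_t^{ij} E_{C_t}[∂_i∂_j∂_vΨ(y+·)]`, uniformly in `y`. [cite: BauerschmidtBodineauDagallier2023, Proposition 5] -/
theorem sm_partial_uniformSlope (D : CovDecomposition N) (hΨ : ContDiff ℝ 4 Ψ)
    (hB : ∀ n ≤ 4, ∀ x, ‖iteratedFDeriv ℝ n Ψ x‖ ≤ B) (v : EuclideanSpace ℝ (Fin N)) {t : ℝ} (ht : 0 < t) :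
    ∀ ε : ℝ, 0 < ε → ∀ᶠ s in 𝓝 t, ∀ y : EuclideanSpace ℝ (Fin N),
      |(∫ ζ, fderiv ℝ Ψ (y + ζ) v ∂(multivariateGaussian 0 (D.C s))) -
          (∫ ζ, fderiv ℝ Ψ (y + ζ) v ∂(multivariateGaussian 0 (D.C t))) -
          (s - t) * ((1 / 2) * ∑ i, ∑ j, D.Cdot t i j *
            ∫ w, fderiv ℝ (fderiv ℝ (fderiv ℝ Ψ)) (y + w) v (EuclideanSpace.single i 1)
              (EuclideanSpace.single j 1) ∂(multivariateGaussian 0 (D.C t)))| ≤ ε * |s - t| :=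
  fun _ hε => eventually_abs_integral_sub_sub_mul_le D (G := fun x => fderiv ℝ Ψ x v)
    (Cb4.hasFDerivAt_partial hΨ v) (Cb4.hasFDerivAt_fderiv_partial hΨ v) (Cb4.abs_partial_le hB v)
    (Cb4.norm_fderiv₃_apply_le hB v) (Cb4.uniformContinuous_fderiv₃_apply hΨ hB v) ht hε

end Atoms

/-! ### Positivity: lower and upper bounds for `Z = E_P[e^{−V₀}]` and `W = E_P[e^{−V₀}F]` -/

section Positivity

variable {V₀ F : EuclideanSpace ℝ (Fin N) → ℝ} {BV : ℝ}

/-- Integrability of `e^{−V₀(y+ζ)}` for continuous `V₀` with `|V₀| ≤ B_V`. [folklore] -/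
private theorem integrable_exp_neg_shift (hV : Continuous V₀) (hVB : ∀ x, |V₀ x| ≤ BV)
    (P : Measure (EuclideanSpace ℝ (Fin N))) [IsProbabilityMeasure P] (y : EuclideanSpace ℝ (Fin N)) :
    Integrable (fun ζ => Real.exp (-V₀ (y + ζ))) P :=
  integrable_shift (Y := ℝ) (H := fun x => Real.exp (-V₀ x)) (Real.continuous_exp.comp hV.neg)
    (MH := Real.exp BV) (fun x => by
      rw [Real.norm_eq_abs, abs_of_pos (Real.exp_pos _), Real.exp_le_exp]
      exact (neg_le_abs _).trans (hVB x)) P y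

/-- `E_P[e^{−V₀(y+ζ)}] ≥ e^{−B_V}` when `|V₀| ≤ B_V`. [cite: BauerschmidtBodineauDagallier2023, Theorem 3 (proof)] -/
theorem exp_neg_le_integral_exp_neg (hV : Continuous V₀) (hVB : ∀ x, |V₀ x| ≤ BV)
    (P : Measure (EuclideanSpace ℝ (Fin N))) [IsProbabilityMeasure P] (y : EuclideanSpace ℝ (Fin N)) :
    Real.exp (-BV) ≤ ∫ ζ, Real.exp (-V₀ (y + ζ)) ∂P := by
  calc Real.exp (-BV) = ∫ _ζ, Real.exp (-BV) ∂P := by simp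
    _ ≤ ∫ ζ, Real.exp (-V₀ (y + ζ)) ∂P :=
      integral_mono (integrable_const _) (integrable_exp_neg_shift hV hVB P y) fun ζ =>
        Real.exp_le_exp.2 (neg_le_neg (le_trans (le_abs_self _) (hVB _)))

/-- `a·E_P[e^{−V₀(y+ζ)}] ≤ E_P[e^{−V₀}F(y+ζ)] ≤ b·E_P[e^{−V₀(y+ζ)}]` when `a ≤ F ≤ b` (so that
`a ≤ P_{0,t}F ≤ b`). [cite: BauerschmidtBodineauDagallier2023, Proposition 8] -/
theorem integral_exp_neg_mul_mem (hV : Continuous V₀) (hVB : ∀ x, |V₀ x| ≤ BV) (hF : Continuous F)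
    {a b : ℝ} (hab : ∀ x, a ≤ F x ∧ F x ≤ b)
    (P : Measure (EuclideanSpace ℝ (Fin N))) [IsProbabilityMeasure P] (y : EuclideanSpace ℝ (Fin N)) :
    a * (∫ ζ, Real.exp (-V₀ (y + ζ)) ∂P) ≤ ∫ ζ, Real.exp (-V₀ (y + ζ)) * F (y + ζ) ∂P ∧
    ∫ ζ, Real.exp (-V₀ (y + ζ)) * F (y + ζ) ∂P ≤ b * ∫ ζ, Real.exp (-V₀ (y + ζ)) ∂P := by
  have hI := integrable_exp_neg_shift hV hVB P y
  have hKF : ∀ x, |F x| ≤ max |a| |b| := fun x =>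
    abs_le_max_abs_abs (hab x).1 (hab x).2
  have hIF : Integrable (fun ζ => Real.exp (-V₀ (y + ζ)) * F (y + ζ)) P :=
    integrable_shift (Y := ℝ) (H := fun x => Real.exp (-V₀ x) * F x)
      ((Real.continuous_exp.comp hV.neg).mul hF) (MH := Real.exp BV * max |a| |b|) (fun x => by
        rw [norm_mul, Real.norm_eq_abs, Real.norm_eq_abs, abs_of_pos (Real.exp_pos _)]
        refine mul_le_mul ?_ (hKF x) (abs_nonneg _) (Real.exp_pos _).le
        rw [Real.exp_le_exp]
        exact (neg_le_abs _).trans (hVB x)) P y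
  constructor
  · rw [← integral_const_mul]
    refine integral_mono (hI.const_mul a) hIF fun ζ => ?_
    simp only [mul_comm a]
    exact mul_le_mul_of_nonneg_left (hab _).1 (Real.exp_pos _).le
  · rw [← integral_const_mul]
    refine integral_mono hIF (hI.const_mul b) fun ζ => ?_
    simp only [mul_comm b]
    exact mul_le_mul_of_nonneg_left (hab _).2 (Real.exp_pos _).le

/-- `e^{−V₀}F ≥ a e^{−B_V}` on average: `a·e^{−B_V} ≤ E_P[e^{−V₀}F(y+ζ)]` for `0 ≤ a ≤ F`, `|V₀| ≤ B_V`.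
[cite: BauerschmidtBodineauDagallier2023, Theorem 3 (proof)] -/
theorem mul_exp_neg_le_integral_exp_neg_mul (hV : Continuous V₀) (hVB : ∀ x, |V₀ x| ≤ BV)
    (hF : Continuous F) {a b : ℝ} (ha : 0 ≤ a) (hab : ∀ x, a ≤ F x ∧ F x ≤ b)
    (P : Measure (EuclideanSpace ℝ (Fin N))) [IsProbabilityMeasure P] (y : EuclideanSpace ℝ (Fin N)) :
    a * Real.exp (-BV) ≤ ∫ ζ, Real.exp (-V₀ (y + ζ)) * F (y + ζ) ∂P :=
  (mul_le_mul_of_nonneg_left (exp_neg_le_integral_exp_neg hV hVB P y) ha).trans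
    (integral_exp_neg_mul_mem hV hVB hF hab P y).1

end Positivity

end Polchinski

end Literature.Analysis.FunctionSpaces

end
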